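import Literature.AlgebraicGeometry.Resolution.EffectiveResolutionSpread
import Literature.AlgebraicGeometry.Resolution.KollarOrderReductionProofs
import HarnessLib

/-!
# (C0) — resolution of `(𝔸ⁿ_K, (S), ∅, 1)` in characteristic zero — from the leaves of Kollár's induction 3.70

Topic: `Literature/AlgebraicGeometry/Resolution`. Sibling bookkeeping file of
`EffectiveResolutionSpread.lean` for its characteristic-zero input (C0): for every field `K` of
characteristic zero and every finite `S ⊆ K[x₁, …, xₙ]`, the marked ideal
`(𝔸ⁿ_K, 𝓘_{V(S)}, ∅, 1)` has a resolution, `HasMarkedResolution K n S`. No new notion, no new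
named fact. (C0) is NOT a declaration of the tree (D-0026 review 2026-08-15: the former
pass-through definition naming it was merged back into the implication below; it is the special
case `X = 𝔸ⁿ_K`, `m = 1`, `E = ∅` of Kollár's Thm. 3.69): it is written out as the conclusion of
the theorems of this file and as the hypothesis of its two users,
`marked_of_charZero_of_spreads` (`EffectiveResolutionSpread.lean`) and
`bierstoneGrigorievMilmanWlodarczyk2011_of_charZero` (`EffectiveResolutionCharZeroReduction.lean`).

`EffectiveResolutionSpread.lean` PROVES
`charZeroMarkedResolution_of_kollar : Kollar2007MarkedOrderReduction.{0} → (C0)`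
(J. Kollár, *Lectures on Resolution of Singularities* (2007), Thm. 3.69 (1) with `E = ∅`, `m = 1`
on `X = 𝔸ⁿ_K`; the case `𝓘_{V(S)} = 0` being the one-step resolution by the empty blow-up). In the
tree the named fact `Kollar2007MarkedOrderReduction` (`KollarOrderReduction.lean`) is in turn
PROVED (`Kollar2007MarkedOrderReduction_of`, `KollarOrderReductionProofs.lean`) from the two
inductive steps of Kollár's 3.70 ("We prove (3.68) and (3.69) together in two main reduction
steps", p. 150 of the held copy), the NAMED FACTS `Kollar2007Thm3_103` (Thm. 3.103 = (3.70.1),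
p. 171) and `Kollar2007Thm3_107` (Thm. 3.107 = (3.70.2), p. 175) of
`KollarBlowupSequenceFunctors.lean`, through Thm. 3.69 in every dimension
(`Kollar2007.MarkedOrderReductionInDim`, `Kollar2007Thm3_103.orderReduction` and
`kollar2007MarkedOrderReduction_of_inDim`, PROVED there); and Step 3 of the proof of Thm. 3.103
is PROVED from its maximal contact case 3.104 (`Kollar2007Thm3_103_of_maxContactCase`,
`KollarOrderReductionMaxContact.lean`). This file records the composites at universe `0` (the
universe of (C0), whose fields `K : Type`), so that (C0) visibly rests on exactly those leaves
and the import path from the Kollár files to `EffectiveResolutionSpread.lean` is exercised now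
(all PROVED; compare `EffectiveResolutionKollarLeaves.lean`, the same bookkeeping for
`BierstoneGrigorievMilmanWlodarczyk2011`):

* `charZeroMarkedResolution_of_markedOrderReductionInDim` —
  **(3.69) in all dimensions (universe `0`) ⟹ (C0)**;
* `charZeroMarkedResolution_of_kollarThms` —
  **`Kollar2007Thm3_103.{0} → Kollar2007Thm3_107.{0} → (C0)`**;
* `charZeroMarkedResolution_of_maxContactCase` — the same from Kollár's 3.104 (order reduction
  functors in the maximal contact case, `Kollar2007.IsMaxContactOrderReduction`) and
  `Kollar2007Thm3_107`.

Hence, once the two leaves are discharged, (C0) is available closed as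
`charZeroMarkedResolution_of_kollarThms Kollar2007Thm3_103_holds Kollar2007Thm3_107_holds`
(equivalently `charZeroMarkedResolution_of_kollar Kollar2007MarkedOrderReduction_holds`).

## Sources

* J. Kollár, *Lectures on Resolution of Singularities*, Ann. of Math. Stud. 166, PUP 2007:
  Thms. 3.68–3.69 and 3.70 (p. 150), Thm. 3.103 (p. 171), 3.104 (p. 172), Thm. 3.107 (p. 175) —
  page numbers of the held copy (`book:kollar2007-lectures-resolution-singularities`). [Kollar2007]
* E. Bierstone, D. Grigoriev, P. Milman, J. Włodarczyk, *Effective Hironaka resolution and its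
  complexity*, Asian J. Math. 15 (2011) / arXiv:1206.3090, Thm. 4.0.6 (resolution of marked
  ideals in characteristic zero; first line of its proof for `𝓘 = 0`).
  [BierstoneGrigorievMilmanWlodarczyk2011]
-/

open MvPolynomial

namespace Literature.AlgebraicGeometry.Resolution

/-- **(C0) from Kollár's Thm. 3.69 in every dimension** (universe `0`):
`Kollar2007.MarkedOrderReductionInDim n` for all `n` gives `Kollar2007MarkedOrderReduction`
(`kollar2007MarkedOrderReduction_of_inDim`), whence (C0) by `charZeroMarkedResolution_of_kollar`.
[cite: Kollar2007, Thm. 3.69 (p. 150)] -/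
theorem charZeroMarkedResolution_of_markedOrderReductionInDim
    (h : ∀ n : ℕ, Kollar2007.MarkedOrderReductionInDim.{0} n)
    (K : Type) [Field K] [CharZero K] (n : ℕ) (S : Finset (MvPolynomial (Fin n) K)) :
    HasMarkedResolution K n S :=
  charZeroMarkedResolution_of_kollar (kollar2007MarkedOrderReduction_of_inDim h) K n S

/-- **(C0) from Kollár's two inductive steps 3.103 and 3.107** (at universe `0`): by Kollár's
induction 3.70 they give Thm. 3.69 (1) with `E = ∅` (`Kollar2007MarkedOrderReduction_of`). After
this theorem (C0) rests on exactly the two named facts `Kollar2007Thm3_103`, `Kollar2007Thm3_107`.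
[cite: Kollar2007, 3.70 (p. 150), Thms. 3.103 (p. 171), 3.107 (p. 175)] -/
theorem charZeroMarkedResolution_of_kollarThms (h103 : Kollar2007Thm3_103.{0})
    (h107 : Kollar2007Thm3_107.{0})
    (K : Type) [Field K] [CharZero K] (n : ℕ) (S : Finset (MvPolynomial (Fin n) K)) :
    HasMarkedResolution K n S :=
  charZeroMarkedResolution_of_kollar (Kollar2007MarkedOrderReduction_of h103 h107) K n S

/-- **(C0) from Kollár's 3.104 and 3.107** (at universe `0`): if, assuming Thm. 3.69 in
dimensions `< n`, order reduction functors exist in the maximal contact case for every marking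
`m ≥ 1` (Kollár 3.104, `Kollar2007.IsMaxContactOrderReduction`), then Thm. 3.103 holds
(`Kollar2007Thm3_103_of_maxContactCase`, the globalization Step 3 of its proof), and the
previous theorem applies (`Kollar2007MarkedOrderReduction_of_maxContactCase`).
[cite: Kollar2007, 3.104 (p. 172), proof of Thm. 3.103 Step 3 (pp. 171–173), Thm. 3.107 (p. 175)] -/
theorem charZeroMarkedResolution_of_maxContactCase
    (h104 : ∀ n : ℕ, (∀ n' < n, Kollar2007.MarkedOrderReductionInDim.{0} n') →
      ∀ m : ℕ, 1 ≤ m → ∃ B : Kollar2007.BlowupSequenceFunctor.{0} n,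
        Kollar2007.IsMaxContactOrderReduction n m B)
    (h107 : Kollar2007Thm3_107.{0})
    (K : Type) [Field K] [CharZero K] (n : ℕ) (S : Finset (MvPolynomial (Fin n) K)) :
    HasMarkedResolution K n S :=
  charZeroMarkedResolution_of_kollar (Kollar2007MarkedOrderReduction_of_maxContactCase h104 h107)
    K n S

end Literature.AlgebraicGeometry.Resolution
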